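import Summits.Ventures.DiscreteObjects.PP12.FlagOrbitBlocks
import Summits.Ventures.DiscreteObjects.PP12.FlagTenOrbitMatrix

/-!
# A plain `ρ = 1` orbit matrix carries the structured `f = 10` data, I: extraction of `φ, ψ, γ, C, β` (kernel; converse bridge, data part)
Framing: lottery ticket; floor = certified bounds/negative ranges.

Cell pub-namedobj (venture DiscreteObjects), target (M), designs gen 15. For `ρ = 1` (`f = 10`) the plain statement `IsFlagOrbitMatrix 1 M`
(p344983; `49 × 49` non-trivial part: the c-line orbit `Γ`, `12` side orbits, `36` T-line orbits / the `l`-orbit `Z`, `12` triangles, `36` T-point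
orbits) DETERMINES designs g12's structured data `FlagTenOrbitData` (p322607): `φ` (triangle `i` is inscribed in `φ i`: the unique side row
`≠ i` with a `1` in the triangle column `i` — unique by the column total), its inverse `ψ` (the unique off-diagonal `1` of a side row in the
triangle block — `tri_block_sum` and the diagonal `2`), `γ j i` / `β k j t` (the unique T-point orbit on `m_j` met — `FlagOrbitBlocks.tpt_block`) and
`C k i` (the unique T-line orbit through `y_k` meeting triangle `i` — T-rows through one `y_k` are orthogonal `0/1` rows with block sums `3`), and
this file DEFINES the extracted data `tenDataOfPlain h : FlagTenOrbitData` together with the closed forms of all entries (`sd_tr_eq`, `tl_tr_eq`,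
`sd_tp_eq`, `tl_tp_eq`, constants on the c-line row and the `Z`-column) and `ψ ∘ φ = φ ∘ ψ = id`. The ten conjuncts of `IsFlagTenOrbitMatrix` and the
bridge `NoFlagTenOrbitMatrix → NoFlagOrbitMatrix 1` are `FlagOrbitBridgeTen.lean`. Nothing here decides any census statement. No `sorry`, no new axioms.
-/

namespace Summit.Ventures.DiscreteObjects.PP12

open Finset
open scoped Classical

/-! ### Small counting helpers -/

/-- A family of naturals with sum `1` has one member equal to `1` and all others `0`. -/
theorem exists_eq_one_of_sum_eq_one {ι : Type*} [Fintype ι] [DecidableEq ι] (g : ι → ℕ) (h : ∑ i, g i = 1) :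
    ∃ i₀, g i₀ = 1 ∧ ∀ i, i ≠ i₀ → g i = 0 := by
  have hne : ∃ i, g i ≠ 0 := by
    by_contra hall
    push Not at hall
    have : ∑ i, g i = 0 := Finset.sum_eq_zero fun i _ => hall i
    omega
  obtain ⟨i₀, hi₀⟩ := hne
  have hsplit : ∑ i, g i = g i₀ + ∑ i ∈ univ.erase i₀, g i := (Finset.add_sum_erase univ g (mem_univ i₀)).symm
  rw [h] at hsplit
  have hg : g i₀ = 1 := by omega
  refine ⟨i₀, hg, fun i hi => ?_⟩
  have hrest : ∑ i ∈ univ.erase i₀, g i = 0 := by omega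
  exact (Finset.sum_eq_zero_iff.1 hrest) i (mem_erase.2 ⟨hi, mem_univ i⟩)

namespace IsFlagOrbitMatrix

variable {M : FRow 1 → FCol 1 → ℕ}

/-- side row `i` (`ρ = 1`) -/
abbrev sd (i : Fin 12) : FRow 1 := Sum.inr (Sum.inl (0, i))
/-- triangle column `i` -/
abbrev tr (i : Fin 12) : FCol 1 := Sum.inr (Sum.inl (0, i))
/-- T-line row `(k,t)` -/
abbrev tl (k : Fin 9) (t : Fin 4) : FRow 1 := Sum.inr (Sum.inr (k, t))
/-- T-point column `(j,t)` -/
abbrev tp (j : Fin 9) (t : Fin 4) : FCol 1 := Sum.inr (Sum.inr (j, t))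
/-- the `Z`-column -/
abbrev zc : FCol 1 := Sum.inl 0
/-- the c-line row -/
abbrev gr : FRow 1 := Sum.inl 0

/-- Two orthogonal rows have no common support. -/
theorem entry_mul_eq_zero_of_rows {ρ : ℕ} {M : FRow ρ → FCol ρ → ℕ} (h : IsFlagOrbitMatrix ρ M) {r₁ r₂ : FRow ρ}
    (h0 : FlagOrbit.rowTarget r₁ r₂ = 0) (c : FCol ρ) : M r₁ c * M r₂ c = 0 := by
  have hs := h.2.2.1 r₁ r₂
  rw [h0] at hs
  exact (Finset.sum_eq_zero_iff.1 hs) c (mem_univ c)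

/-- Block decomposition of a row product for `ρ = 1`: `Z`-term + triangle block + T-point block. -/
theorem row_product_split (r r' : FRow 1) :
    ∑ c : FCol 1, M r c * M r' c
      = M r zc * M r' zc + ∑ i : Fin 12, M r (tr i) * M r' (tr i) + ∑ jt : Fin 9 × Fin 4, M r (tp jt.1 jt.2) * M r' (tp jt.1 jt.2) := by
  rw [Fintype.sum_sum_type, Fintype.sum_sum_type, Fin.sum_univ_one, Fintype.sum_prod_type, Fin.sum_univ_one, add_assoc]

/-- Block decomposition of a column product for `ρ = 1`: c-line term + side block + T-line block. -/
theorem col_product_split (c c' : FCol 1) :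
    ∑ r : FRow 1, M r c * M r c'
      = M gr c * M gr c' + ∑ i : Fin 12, M (sd i) c * M (sd i) c' + ∑ kt : Fin 9 × Fin 4, M (tl kt.1 kt.2) c * M (tl kt.1 kt.2) c' := by
  rw [Fintype.sum_sum_type, Fintype.sum_sum_type, Fin.sum_univ_one, Fintype.sum_prod_type, Fin.sum_univ_one, add_assoc]

/-- Block decomposition of a column total. -/
theorem col_sum_split (c : FCol 1) :
    ∑ r : FRow 1, M r c = M gr c + ∑ i : Fin 12, M (sd i) c + ∑ kt : Fin 9 × Fin 4, M (tl kt.1 kt.2) c := by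
  rw [Fintype.sum_sum_type, Fintype.sum_sum_type, Fin.sum_univ_one, Fintype.sum_prod_type, Fin.sum_univ_one, add_assoc]

/-! ### Constant entries -/

/-- c-line row: `1` on every triangle. -/
theorem gr_tr (h : IsFlagOrbitMatrix 1 M) (i : Fin 12) : M gr (tr i) = 1 := by
  rw [h.2.2.2.2.1 0 (tr i)]; simp [FlagOrbit.gammaEntry]
/-- c-line row: `0` on the T-point orbits. -/
theorem gr_tp (h : IsFlagOrbitMatrix 1 M) (j : Fin 9) (t : Fin 4) : M gr (tp j t) = 0 := by
  rw [h.2.2.2.2.1 0 (tp j t)]; simp [FlagOrbit.gammaEntry]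
/-- c-line row: `0` on `Z`. -/
theorem gr_zc (h : IsFlagOrbitMatrix 1 M) : M gr zc = 0 := by
  rw [h.2.2.2.2.1 0 zc]; simp [FlagOrbit.gammaEntry]
/-- T-line rows vanish on `Z`. -/
theorem tl_zc (h : IsFlagOrbitMatrix 1 M) (k : Fin 9) (t : Fin 4) : M (tl k t) zc = 0 := h.2.2.2.2.2.1 (k, t) 0
/-- side diagonal `2`. -/
theorem sd_tr_self (h : IsFlagOrbitMatrix 1 M) (i : Fin 12) : M (sd i) (tr i) = 2 := h.2.2.2.2.2.2 (0, i)
/-- every side passes through `Z` (`ρ = 1`). -/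
theorem sd_zc (h : IsFlagOrbitMatrix 1 M) (i : Fin 12) : M (sd i) zc = 1 := by
  have := side_Z_block h (0, i)
  rw [Fin.sum_univ_one] at this
  exact this
/-- T-line rows are `0/1`. -/
theorem tl_le_one (h : IsFlagOrbitMatrix 1 M) (k : Fin 9) (t : Fin 4) (c : FCol 1) : M (tl k t) c ≤ 1 :=
  entry_le_one_of_not_side h _ (fun x hh => by cases hh) c
/-- T-point columns are `0/1`. -/
theorem tp_le_one (h : IsFlagOrbitMatrix 1 M) (j : Fin 9) (t : Fin 4) (r : FRow 1) : M r (tp j t) ≤ 1 :=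
  col_entry_le_one_of_not_tri h _ (fun x hh => by cases hh) r

/-! ### Extraction of `ψ`, `φ`, `γ`, `C`, `β` -/

/-- The off-diagonal triangle entries of a side row sum to `1`. -/
theorem sd_tr_offdiag_sum (h : IsFlagOrbitMatrix 1 M) (i : Fin 12) : ∑ i', (if i' = i then 0 else M (sd i) (tr i')) = 1 := by
  have h3 := tri_block_sum h 0 (sd i) (fun s hh => by cases hh)
  have hsplit := (Finset.add_sum_erase univ (fun i' => M (sd i) (tr i')) (mem_univ i)).symm
  rw [h3, sd_tr_self h i] at hsplit
  rw [← Finset.add_sum_erase univ _ (mem_univ i), if_pos rfl, zero_add]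
  rw [Finset.sum_congr rfl (fun i' hi' => if_neg (ne_of_mem_erase hi'))]
  omega

/-- `ψ i`: the triangle of the odd point of the sides of `i` — the unique `i' ≠ i` with `M (side i) (triangle i') = 1`. -/
noncomputable def psi (h : IsFlagOrbitMatrix 1 M) (i : Fin 12) : Fin 12 :=
  (exists_eq_one_of_sum_eq_one _ (sd_tr_offdiag_sum h i)).choose

/-- `ψ i ≠ i`, the entry at `ψ i` is `1`, all other off-diagonal entries vanish. -/
theorem psi_spec (h : IsFlagOrbitMatrix 1 M) (i : Fin 12) :
    psi h i ≠ i ∧ M (sd i) (tr (psi h i)) = 1 ∧ ∀ i', i' ≠ i → i' ≠ psi h i → M (sd i) (tr i') = 0 := by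
  have hs := (exists_eq_one_of_sum_eq_one _ (sd_tr_offdiag_sum h i)).choose_spec
  set i₀ := (exists_eq_one_of_sum_eq_one _ (sd_tr_offdiag_sum h i)).choose with hi₀
  change i₀ ≠ i ∧ M (sd i) (tr i₀) = 1 ∧ ∀ i', i' ≠ i → i' ≠ i₀ → M (sd i) (tr i') = 0
  have hne : i₀ ≠ i := by intro e; have := hs.1; rw [if_pos e] at this; exact absurd this (by norm_num)
  refine ⟨hne, by have := hs.1; rwa [if_neg hne] at this, fun i' h1 h2 => ?_⟩
  have := hs.2 i' h2; rwa [if_neg h1] at this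

/-- Closed form of the side/triangle entries: `2` on the diagonal, `1` at `ψ i`, `0` elsewhere. -/
theorem sd_tr_eq (h : IsFlagOrbitMatrix 1 M) (i i' : Fin 12) :
    M (sd i) (tr i') = if i' = i then 2 else if i' = psi h i then 1 else 0 := by
  obtain ⟨hne, h1, h0⟩ := psi_spec h i
  by_cases e : i' = i
  · rw [if_pos e, e]; exact sd_tr_self h i
  · rw [if_neg e]
    by_cases e' : i' = psi h i
    · rw [if_pos e', e']; exact h1
    · rw [if_neg e']; exact h0 i' e e'

/-- For each fixed point `y_k`, triangle `i` meets exactly one T-line orbit through `y_k`: `Σ_t M (k,t) (triangle i) = 1`. -/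
theorem tl_tr_sum (h : IsFlagOrbitMatrix 1 M) (k : Fin 9) (i : Fin 12) : ∑ t : Fin 4, M (tl k t) (tr i) = 1 := by
  -- each Σ_t ≤ 1 (orthogonal 0/1 rows), and Σ_i Σ_t = Σ_t 3 = 12
  have hle : ∀ i' : Fin 12, ∑ t : Fin 4, M (tl k t) (tr i') ≤ 1 := by
    intro i'
    refine block_sum_le_one _ (fun t => tl_le_one h k t _) fun t t' htt => ?_
    exact entry_mul_eq_zero_of_rows h (by simp [FlagOrbit.rowTarget, htt]) _
  have htot : ∑ i' : Fin 12, ∑ t : Fin 4, M (tl k t) (tr i') = Fintype.card (Fin 12) := by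
    rw [Finset.sum_comm]
    have : ∀ t : Fin 4, ∑ i' : Fin 12, M (tl k t) (tr i') = 3 := fun t => tri_block_sum h 0 (tl k t) (fun s hh => by cases hh)
    rw [Finset.sum_congr rfl (fun t _ => this t)]
    simp
  exact eq_one_of_sum_eq_card _ hle htot i

/-- `C k i`: the unique T-line orbit through `y_k` containing a vertex of triangle `i`. -/
noncomputable def cee (h : IsFlagOrbitMatrix 1 M) (k : Fin 9) (i : Fin 12) : Fin 4 :=
  (exists_eq_one_of_sum_eq_one _ (tl_tr_sum h k i)).choose

/-- Closed form of the T-line/triangle entries. -/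
theorem tl_tr_eq (h : IsFlagOrbitMatrix 1 M) (k : Fin 9) (t : Fin 4) (i : Fin 12) :
    M (tl k t) (tr i) = if cee h k i = t then 1 else 0 := by
  have hs := (exists_eq_one_of_sum_eq_one _ (tl_tr_sum h k i)).choose_spec
  set t₀ := (exists_eq_one_of_sum_eq_one _ (tl_tr_sum h k i)).choose
  change M (tl k t) (tr i) = if t₀ = t then 1 else 0
  by_cases e : t₀ = t
  · rw [if_pos e, ← e]; exact hs.1
  · rw [if_neg e]; exact hs.2 t (fun e' => e e'.symm)

/-- `γ j i`: the unique T-point orbit on `m_j` met by the sides of triangle `i`. -/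
noncomputable def gam (h : IsFlagOrbitMatrix 1 M) (j : Fin 9) (i : Fin 12) : Fin 4 :=
  (exists_eq_one_of_sum_eq_one _ (tpt_block h (sd i) (fun s hh => by cases hh) j)).choose

/-- Closed form of the side/T-point entries. -/
theorem sd_tp_eq (h : IsFlagOrbitMatrix 1 M) (i : Fin 12) (j : Fin 9) (t : Fin 4) :
    M (sd i) (tp j t) = if gam h j i = t then 1 else 0 := by
  have hs := (exists_eq_one_of_sum_eq_one _ (tpt_block h (sd i) (fun s hh => by cases hh) j)).choose_spec
  set t₀ := (exists_eq_one_of_sum_eq_one _ (tpt_block h (sd i) (fun s hh => by cases hh) j)).choose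
  change M (sd i) (tp j t) = if t₀ = t then 1 else 0
  by_cases e : t₀ = t
  · rw [if_pos e, ← e]; exact hs.1
  · rw [if_neg e]; exact hs.2 t (fun e' => e e'.symm)

/-- `β k j t`: the unique T-point orbit on `m_j` met by the T-line orbit `(k,t)`. -/
noncomputable def bet (h : IsFlagOrbitMatrix 1 M) (k j : Fin 9) (t : Fin 4) : Fin 4 :=
  (exists_eq_one_of_sum_eq_one _ (tpt_block h (tl k t) (fun s hh => by cases hh) j)).choose

/-- Closed form of the T-line/T-point entries. -/
theorem tl_tp_eq (h : IsFlagOrbitMatrix 1 M) (k : Fin 9) (t : Fin 4) (j : Fin 9) (t' : Fin 4) :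
    M (tl k t) (tp j t') = if bet h k j t = t' then 1 else 0 := by
  have hs := (exists_eq_one_of_sum_eq_one _ (tpt_block h (tl k t) (fun s hh => by cases hh) j)).choose_spec
  set t₀ := (exists_eq_one_of_sum_eq_one _ (tpt_block h (tl k t) (fun s hh => by cases hh) j)).choose
  change M (tl k t) (tp j t') = if t₀ = t' then 1 else 0
  by_cases e : t₀ = t'
  · rw [if_pos e, ← e]; exact hs.1
  · rw [if_neg e]; exact hs.2 t' (fun e' => e e'.symm)

/-- The side entries of a triangle column off the diagonal sum to `1` (column total `13 = 1 + (2 + 1) + 9`). -/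
theorem sd_tr_col_offdiag_sum (h : IsFlagOrbitMatrix 1 M) (i : Fin 12) : ∑ i', (if i' = i then 0 else M (sd i') (tr i)) = 1 := by
  have hcol := h.2.1 (tr i)
  rw [col_sum_split, gr_tr h i, Fintype.sum_prod_type] at hcol
  rw [Finset.sum_congr rfl (fun k _ => tl_tr_sum h k i)] at hcol
  simp only [FlagOrbit.colSum, Finset.sum_const, Finset.card_univ, Fintype.card_fin, smul_eq_mul, mul_one] at hcol
  have hsplit := (Finset.add_sum_erase univ (fun i' => M (sd i') (tr i)) (mem_univ i)).symm
  rw [sd_tr_self h i] at hsplit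
  rw [← Finset.add_sum_erase univ _ (mem_univ i), if_pos rfl, zero_add]
  rw [Finset.sum_congr rfl (fun i' hi' => if_neg (ne_of_mem_erase hi'))]
  omega

/-- `φ i`: the triangle in which triangle `i` is inscribed — the unique side row `≠ i` with a `1` in the triangle column `i`. -/
noncomputable def phi (h : IsFlagOrbitMatrix 1 M) (i : Fin 12) : Fin 12 :=
  (exists_eq_one_of_sum_eq_one _ (sd_tr_col_offdiag_sum h i)).choose

/-- `φ i ≠ i` and the side row `φ i` has a `1` in the triangle column `i`. -/
theorem phi_spec (h : IsFlagOrbitMatrix 1 M) (i : Fin 12) : phi h i ≠ i ∧ M (sd (phi h i)) (tr i) = 1 := by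
  have hs := (exists_eq_one_of_sum_eq_one _ (sd_tr_col_offdiag_sum h i)).choose_spec
  set i₀ := (exists_eq_one_of_sum_eq_one _ (sd_tr_col_offdiag_sum h i)).choose
  change i₀ ≠ i ∧ M (sd i₀) (tr i) = 1
  have hne : i₀ ≠ i := by intro e; have := hs.1; rw [if_pos e] at this; exact absurd this (by norm_num)
  exact ⟨hne, by have := hs.1; rwa [if_neg hne] at this⟩

/-- `ψ (φ i) = i`. -/
theorem psi_phi (h : IsFlagOrbitMatrix 1 M) (i : Fin 12) : psi h (phi h i) = i := by
  obtain ⟨hne, h1⟩ := phi_spec h i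
  have := sd_tr_eq h (phi h i) i
  rw [h1, if_neg hne.symm] at this
  by_contra e
  rw [if_neg (fun e' => e e'.symm)] at this
  exact absurd this (by norm_num)

/-- `φ (ψ i) = i`. -/
theorem phi_psi (h : IsFlagOrbitMatrix 1 M) (i : Fin 12) : phi h (psi h i) = i := by
  -- the unique side row ≠ ψ i with a 1 in column ψ i is i
  have hs := (exists_eq_one_of_sum_eq_one _ (sd_tr_col_offdiag_sum h (psi h i))).choose_spec
  set i₀ := (exists_eq_one_of_sum_eq_one _ (sd_tr_col_offdiag_sum h (psi h i))).choose
  change i₀ = i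
  obtain ⟨hne, h1, -⟩ := psi_spec h i
  by_contra e
  have := hs.2 i (fun e' => e e'.symm)
  rw [if_neg hne.symm, h1] at this
  exact absurd this (by norm_num)

/-- `φ` as a permutation of the twelve triangles (inverse `ψ`). -/
noncomputable def phiEquivOfPlain (h : IsFlagOrbitMatrix 1 M) : Equiv.Perm (Fin 12) :=
  ⟨phi h, psi h, psi_phi h, phi_psi h⟩

/-- **The structured `f = 10` data of a plain `ρ = 1` orbit matrix.** -/
noncomputable def tenDataOfPlain (h : IsFlagOrbitMatrix 1 M) : FlagTenOrbitData :=
  { φ := phiEquivOfPlain h, γ := gam h, C := cee h, β := fun k j t => bet h k j t }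

end IsFlagOrbitMatrix

end Summit.Ventures.DiscreteObjects.PP12
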